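import Literature.MathematicalPhysics.QuantumFieldTheory.PartiallyStochasticAcceptance
import HarnessLib

/-!
# Knechtli–Wolff §4.3: the partially stochastic determinant (PSD) acceptance step is exact

Topic `MathematicalPhysics/QuantumFieldTheory`; sequel of `PartiallyStochasticAcceptance.lean`
(Appendix A: the acceptance rate `F(λ; S)` for a given spectrum and its detailed balance (A.5)) and
of `PseudofermionIntegral.lean` (§4.1 (4.8): detailed balance of the FULLY stochastic step, `S = ∅`).
PUBLISHED RESULTS, proved here (no named fact is introduced, D-0026); wanted by the cell pub-lqcd
(venture `LatticeQCDFlow`, HOME/R2-SCOPE.md §2 row G1 "PSD", §3 E2 "admissible determinant routes":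
the printed family of EXACT acceptance steps interpolating between the exact-determinant step and
the one-noise stochastic step).

The statements as printed.  Knechtli–Wolff, Nucl. Phys. B 663 (2003) 3, §4.3 "Partially stochastic
estimation of determinant ratios": "We assume, that for each spectrum we can identify a set `S` such
that `{λᵢ | i ∈ S}` consists of the `s = |S|` extremal eigenvalues of `M†M` …, which we treat
deterministically.  The associated eigenvectors `{φᵢ | i ∈ S}`, that we choose to be orthonormal,
span an `s` dimensional subspace that we characterize by a projection operator
`P = Σ_{i∈S} φᵢφᵢ† ≡ P(A,A')` (4.29). … going to the reverse process (`A ↔ A'`), `M` changes to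
`M⁻¹`.  Hence in this case we are concerned with the eigenvalue problem of `M⁻¹†M⁻¹ = (MM†)⁻¹`.  Its
eigenvalues are reciprocal to those of `M†M` but the eigenvectors and hence the associated
projectors are different … The problems are however related by a unitary transformation
`MM† = U†M†MU` (4.30) …, `U = M†(MM†)^{−1/2}` (4.31) …, `P(A',A) = U†P(A,A')U` (4.32). … we can
factorize `M†M = (P̄ + PM†M)(P + P̄M†M)` (4.33) where we introduced the complementary projector
`P̄ = 1 − P` (4.34) and
used standard properties of projectors and commutativity `PM†M = M†MP` … The exact "small"
determinant of the first factor is `det(P̄ + PM†M) = ∏_{i∈S} λᵢ` (4.35). … As the true partially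
stochastic acceptance criterion `w_s(A,A')` to accept a proposed `A'` given an 'old' `A` we now
propose `w_s(A,A') = min[1, ∏_{i∈S} λᵢ⁻¹ exp(−η†P̄(M†M − 1)P̄η)]` (4.36).  To prove detailed
balance we start from `w_s(A',A) = min[1, ∏_{i∈S} λᵢ exp(−η†U†P̄U((MM†)⁻¹ − 1)U†P̄Uη)]` (4.37) …
[(4.38)] a change of variables [(4.39)] yields the desired result
`⟨w_s(A,A')⟩_η / ⟨w_s(A',A)⟩_η = ∏_{i∈S}λᵢ⁻¹ det(P + P̄M†M)⁻¹ = |det(M)|⁻²` (4.40).  With the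
above formalism we have an algorithm which avoids the low stochastic acceptance from extremal
eigenvalues if their product is of order unity."  Here `⟨·⟩_η` is the average over
`D[η]ρ(η) = ∏ d Re η d Im η e^{−η†η}/π` (4.2)–(4.4), and (4.8) is the case `S = ∅`; equation numbers
are those PRINTED in the arXiv version (hep-lat/0303001), read from its PDF.

What is proved (finite form, for an invertible complex matrix `M` — the ratio operator
`(D'_W + m)⁻¹(D_W + m)` of (4.6) — and ANY orthonormal eigenbasis of `M†M`, given as a unitary `U`
with `M†M = U diag(λ) U†`, columns `φᵢ = Ueᵢ`; `S : Finset ι` the exactly treated indices):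
* `psdProj U S = U 1_S U†` with `psdProj_apply` : `P = Σ_{i∈S} φᵢφᵢ†` (4.29); `P` is a Hermitian
  idempotent commuting with `M†M`, `1 − P = psdProj U Sᶜ` (= `P̄`, (4.34)); the factorisation (4.33)
  `conjTranspose_mul_self_eq_factor` and **(4.35)** `det_psd_small_factor` :
  `det(P̄ + P M†M) = ∏_{i∈S} λᵢ` (and `det_psd_large_factor`, `prod_mul_det_psd_large_factor` : the
  middle term `∏_{i∈S}λᵢ⁻¹ det(P + P̄M†M)⁻¹ = |det M|⁻²` of (4.40));
* `psdAccept M U lam S η` — the criterion (4.36) — and `psdAccept_eq` : in the eigenbasis,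
  `η†P̄(M†M − 1)P̄η = Σ_{i∈S̄} (λᵢ − 1)|(U†η)ᵢ|²`; `eigenvalue_pos` : `λᵢ > 0`; the extremal cases
  `psdAccept_empty` (`S = ∅`: the fully stochastic `w₀ = min[1, ρ(Mη)/ρ(η)]` of (4.7)) and
  `psdAccept_univ` (`S̄ = ∅`: the exact acceptance `min[1, |det M|⁻²]`, noise-free);
* **`integral_exp_neg_normSq_mul_psdAccept`** : `⟨w_s(A,A')⟩_η = F(λ; S)`, precisely
  `∫_{ℂ^ι} e^{−‖η‖²} w_s(η) dη = π^{|ι|} · psdF λ S` (unitary change of variables `η = Uz`, then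
  `|zᵢ|²` i.i.d. `Exp(1)` — the tools of `StochasticAcceptanceGaussian.lean`);
* the reverse move (4.30)–(4.32): `psdReverseBasis M U lam = M U diag(λ^{−1/2})` is unitary and
  diagonalises `(M⁻¹)†M⁻¹ = (MM†)⁻¹` with the reciprocal eigenvalues
  (`conjTranspose_mul_self_inv_eq`), and its projector is `P(A',A) = M P(A,A') M⁻¹`
  (`psdProj_psdReverseBasis`; this equals the printed `U†P(A,A')U`, `U = M†(MM†)^{−1/2}`, written
  without the operator square root);
* **`psd_detailed_balance`** — KNECHTLI–WOLFF (4.40): for EVERY unitary eigenbasis `U'` of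
  `(M⁻¹)†M⁻¹` carrying the reciprocal eigenvalues,
  `∫ e^{−‖η‖²} w_s[M,U,λ,S](η) dη = |det M|⁻² ∫ e^{−‖η‖²} w_s[M⁻¹,U',λ⁻¹,S](η) dη`, i.e.
  `⟨w_s(A,A')⟩_η / ⟨w_s(A',A)⟩_η = |det M|⁻²` (`psd_detailed_balance_div`), and the instance with
  the explicit reverse basis (`psd_detailed_balance_reverseBasis`); plus the PSD analogue of the
  "Carnot" bound (4.9), `integral_exp_neg_normSq_mul_psdAccept_le`.
The proof of (4.40) here is NOT the printed substitution `η = U†(P + P̄M†M)^{1/2}η'` (4.39) but: both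
sides reduce to `F(λ; S)` resp. `F(λ⁻¹; S)` in their eigenbases, and (A.5) of
`PartiallyStochasticAcceptance.lean` gives `F(λ; S) = (∏λᵢ)⁻¹F(λ⁻¹; S)` with `∏λᵢ = det M†M = |det M|²`
(deviation recorded).  Honest scope: the choice of `S` ("extremal eigenvalues … no degeneracy at the
boundaries of `S`") plays no role in exactness and is not modelled; the Ritz-functional / Lanczos
discussion and §5 are not formalised.

## References
* [KnechtliWolff2003] F. Knechtli, U. Wolff, Dynamical fermions as a global correction, Nucl. Phys.
  B 663 (2003) 3–32 (= hep-lat/0303001), §4.1 (4.2)–(4.9), (4.11)–(4.13), §4.3 (4.29)–(4.40),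
  App. A (A.1), (A.5).
-/

namespace Literature.MathematicalPhysics.QuantumFieldTheory.StochasticAcceptance

open MeasureTheory ProbabilityTheory Real Matrix
open Literature.Probability.Distributions Literature.Analysis.SpecialFunctions
open scoped ENNReal ComplexConjugate ComplexOrder

variable {ι : Type} [Fintype ι] [DecidableEq ι]

/-! ## Unitary bookkeeping -/

section Unitary

/-- `‖Uz‖² = ‖z‖²` (componentwise sums) for `U†U = 1`. [folklore] -/
private theorem sum_normSq_mulVec_of_unitary' {U : Matrix ι ι ℂ} (hU : Uᴴ * U = 1) (z : ι → ℂ) :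
    ∑ i, ‖(U *ᵥ z) i‖ ^ 2 = ∑ i, ‖z i‖ ^ 2 := by
  have h := re_star_dotProduct_conjTranspose_mul_self_mulVec U z
  rw [hU, Matrix.one_mulVec] at h
  rw [← h]
  simp only [dotProduct, Pi.star_apply, Complex.star_def, Complex.conj_mul', Complex.re_sum]
  refine Finset.sum_congr rfl fun i _ => ?_
  norm_cast

/-- `det U† · det U = 1` for `U†U = 1`. [folklore] -/
private theorem det_conjTranspose_mul_det_of_unitary {U : Matrix ι ι ℂ} (hU : Uᴴ * U = 1) :
    Uᴴ.det * U.det = 1 := by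
  rw [← Matrix.det_mul, hU, Matrix.det_one]

/-- `|det U|² = 1` for `U†U = 1`. [folklore] -/
private theorem normSq_det_of_unitary {U : Matrix ι ι ℂ} (hU : Uᴴ * U = 1) :
    Complex.normSq U.det = 1 := by
  have hdet := det_conjTranspose_mul_det_of_unitary hU
  rw [Matrix.det_conjTranspose, Complex.star_def, ← Complex.normSq_eq_conj_mul_self] at hdet
  exact_mod_cast hdet

/-- `det U ≠ 0` for `U†U = 1`. [folklore] -/
private theorem det_ne_zero_of_unitary {U : Matrix ι ι ℂ} (hU : Uᴴ * U = 1) : U.det ≠ 0 := by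
  intro h
  have := normSq_det_of_unitary hU
  rw [h, map_zero] at this
  exact zero_ne_one this

/-- Products of `U diag(·) U†`-sandwiches. [folklore] -/
private theorem sandwich_diag_mul {U : Matrix ι ι ℂ} (hU : Uᴴ * U = 1) (d₁ d₂ : ι → ℂ) :
    U * diagonal d₁ * Uᴴ * (U * diagonal d₂ * Uᴴ) = U * diagonal (fun i => d₁ i * d₂ i) * Uᴴ := by
  calc U * diagonal d₁ * Uᴴ * (U * diagonal d₂ * Uᴴ)
      = U * diagonal d₁ * (Uᴴ * U) * diagonal d₂ * Uᴴ := by simp only [Matrix.mul_assoc]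
    _ = U * diagonal (fun i => d₁ i * d₂ i) * Uᴴ := by
        rw [hU, Matrix.mul_one, ← diagonal_mul_diagonal]; simp only [Matrix.mul_assoc]

/-- Sums of `U diag(·) U†`-sandwiches. [folklore] -/
private theorem sandwich_diag_add (U : Matrix ι ι ℂ) (d₁ d₂ : ι → ℂ) :
    U * diagonal d₁ * Uᴴ + U * diagonal d₂ * Uᴴ = U * diagonal (fun i => d₁ i + d₂ i) * Uᴴ := by
  rw [← Matrix.add_mul, ← Matrix.mul_add, diagonal_add]

/-- Congruence for `U diag(·) U†`-sandwiches. [folklore] -/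
private theorem sandwich_congr (U : Matrix ι ι ℂ) {d₁ d₂ : ι → ℂ} (h : ∀ i, d₁ i = d₂ i) :
    U * diagonal d₁ * Uᴴ = U * diagonal d₂ * Uᴴ := by
  rw [show d₁ = d₂ from funext h]

/-- `U†(U A U†)U = A` for `U†U = 1`. [folklore] -/
private theorem conjTranspose_sandwich {U : Matrix ι ι ℂ} (hU : Uᴴ * U = 1) (A : Matrix ι ι ℂ) :
    Uᴴ * (U * A * Uᴴ) * U = A := by
  calc Uᴴ * (U * A * Uᴴ) * U = (Uᴴ * U) * A * (Uᴴ * U) := by simp only [Matrix.mul_assoc]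
    _ = A := by rw [hU, Matrix.one_mul, Matrix.mul_one]

/-- **The real quadratic form of a `U diag(e) U†`-sandwich**: `Re(η† U diag(e) U† η) = Σᵢ eᵢ |(U†η)ᵢ|²`
("performing the … integration in the basis of orthonormal eigenvectors … with components `zᵢ`").
[cite: KnechtliWolff2003, §4.1 (4.11)–(4.12)] -/
theorem re_star_dotProduct_sandwich_mulVec (U : Matrix ι ι ℂ) (e : ι → ℝ) (η : ι → ℂ) :
    (star η ⬝ᵥ (U * diagonal (fun i => (e i : ℂ)) * Uᴴ) *ᵥ η).re
      = ∑ i, e i * ‖(Uᴴ *ᵥ η) i‖ ^ 2 := by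
  rw [← Matrix.mulVec_mulVec, ← Matrix.mulVec_mulVec, Matrix.dotProduct_mulVec,
    show star η ᵥ* U = star (Uᴴ *ᵥ η) by
      rw [Matrix.star_mulVec, Matrix.conjTranspose_conjTranspose]]
  set w := Uᴴ *ᵥ η with hw
  simp only [dotProduct, mulVec_diagonal, Pi.star_apply, Complex.star_def, Complex.re_sum]
  refine Finset.sum_congr rfl fun i _ => ?_
  rw [← mul_assoc, mul_comm (conj (w i)), mul_assoc, Complex.re_ofReal_mul, Complex.conj_mul']
  norm_cast

end Unitary

/-! ## The projector `P = Σ_{i∈S} φᵢφᵢ†` (4.29), the factorisation (4.33) and the small determinant (4.35) -/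

section Projector

/-- **The PSD projector (4.29)**: for a unitary `U` whose columns `φᵢ = Ueᵢ` are orthonormal
eigenvectors of `M†M`, and a set `S` of indices, `P = Σ_{i∈S} φᵢφᵢ† = U 1_S U†`.
[cite: KnechtliWolff2003, §4.3 eq. (4.29)] -/
def psdProj (U : Matrix ι ι ℂ) (S : Finset ι) : Matrix ι ι ℂ :=
  U * diagonal (fun i => if i ∈ S then (1 : ℂ) else 0) * Uᴴ

/-- **(4.29) entrywise: `P = Σ_{i∈S} φᵢφᵢ†`**, `P_{ab} = Σ_{i∈S} U_{ai} conj(U_{bi})`.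
[cite: KnechtliWolff2003, §4.3 eq. (4.29)] -/
theorem psdProj_apply (U : Matrix ι ι ℂ) (S : Finset ι) (a b : ι) :
    psdProj U S a b = ∑ i ∈ S, U a i * star (U b i) := by
  rw [psdProj, Matrix.mul_apply]
  simp only [mul_diagonal, conjTranspose_apply, mul_ite, mul_one, mul_zero, ite_mul, zero_mul]
  rw [Finset.sum_ite_mem, Finset.univ_inter]

/-- (4.29) as a sum of the rank-one projectors `φᵢφᵢ†`. [cite: KnechtliWolff2003, §4.3 eq. (4.29)] -/
theorem psdProj_eq_sum_vecMulVec (U : Matrix ι ι ℂ) (S : Finset ι) :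
    psdProj U S = ∑ i ∈ S, vecMulVec (fun a => U a i) (star fun a => U a i) := by
  ext a b
  rw [psdProj_apply, Matrix.sum_apply]
  rfl

/-- `P` is Hermitian. [cite: KnechtliWolff2003, §4.3 (4.29) ("projection operator")] -/
theorem psdProj_conjTranspose (U : Matrix ι ι ℂ) (S : Finset ι) :
    (psdProj U S)ᴴ = psdProj U S := by
  rw [psdProj, conjTranspose_mul, conjTranspose_mul, conjTranspose_conjTranspose,
    diagonal_conjTranspose, ← Matrix.mul_assoc]
  refine sandwich_congr U fun i => ?_
  simp only [Pi.star_apply]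
  split_ifs <;> simp

/-- `P² = P` for unitary `U`. [cite: KnechtliWolff2003, §4.3 (4.29) ("projection operator")] -/
theorem psdProj_mul_self {U : Matrix ι ι ℂ} (hU : Uᴴ * U = 1) (S : Finset ι) :
    psdProj U S * psdProj U S = psdProj U S := by
  rw [psdProj, sandwich_diag_mul hU]
  refine sandwich_congr U fun i => ?_
  split_ifs <;> simp

/-- **The complementary projector `P̄ = 1 − P`** is the projector of the complementary index set.
[cite: KnechtliWolff2003, §4.3 eq. (4.34) ("`P̄ = 1 − P`")] -/
theorem one_sub_psdProj {U : Matrix ι ι ℂ} (hU : Uᴴ * U = 1) (S : Finset ι) :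
    1 - psdProj U S = psdProj U Sᶜ := by
  have hU' : U * Uᴴ = 1 := mul_eq_one_comm.mp hU
  have h1 : (1 : Matrix ι ι ℂ) = U * diagonal (fun _ => (1 : ℂ)) * Uᴴ := by
    rw [diagonal_one, Matrix.mul_one, hU']
  rw [psdProj, psdProj, h1, ← Matrix.sub_mul, ← Matrix.mul_sub, diagonal_sub]
  refine sandwich_congr U fun i => ?_
  by_cases h : i ∈ S
  · simp [h]
  · simp [h]

variable {M U : Matrix ι ι ℂ} {lam : ι → ℝ}

/-- `P` commutes with `M†M` ("commutativity `PM†M = M†MP`, which is easily seen in the spectral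
representation of `M†M`"). [cite: KnechtliWolff2003, §4.3 (sentence after (4.34))] -/
theorem psdProj_mul_conjTranspose_mul_self (hU : Uᴴ * U = 1)
    (hdiag : Mᴴ * M = U * diagonal (fun i => (lam i : ℂ)) * Uᴴ) (S : Finset ι) :
    psdProj U S * (Mᴴ * M) = (Mᴴ * M) * psdProj U S := by
  rw [hdiag, psdProj, sandwich_diag_mul hU, sandwich_diag_mul hU]
  exact sandwich_congr U fun i => mul_comm _ _

/-- **The factorisation (4.33)**: `M†M = (P̄ + P M†M)(P + P̄ M†M)`.
[cite: KnechtliWolff2003, §4.3 eq. (4.33)] -/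
theorem conjTranspose_mul_self_eq_factor (hU : Uᴴ * U = 1)
    (hdiag : Mᴴ * M = U * diagonal (fun i => (lam i : ℂ)) * Uᴴ) (S : Finset ι) :
    Mᴴ * M = ((1 - psdProj U S) + psdProj U S * (Mᴴ * M))
      * (psdProj U S + (1 - psdProj U S) * (Mᴴ * M)) := by
  rw [one_sub_psdProj hU, hdiag]
  simp only [psdProj, sandwich_diag_mul hU, sandwich_diag_add]
  refine sandwich_congr U fun i => ?_
  by_cases h : i ∈ S
  · simp [h]
  · simp [h]

/-- **(4.35) the exact "small" determinant**: `det(P̄ + P M†M) = ∏_{i∈S} λᵢ`.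
[cite: KnechtliWolff2003, §4.3 eq. (4.35)] -/
theorem det_psd_small_factor (hU : Uᴴ * U = 1)
    (hdiag : Mᴴ * M = U * diagonal (fun i => (lam i : ℂ)) * Uᴴ) (S : Finset ι) :
    ((1 - psdProj U S) + psdProj U S * (Mᴴ * M)).det = ∏ i ∈ S, (lam i : ℂ) := by
  have hform : (1 - psdProj U S) + psdProj U S * (Mᴴ * M)
      = U * diagonal (fun i => if i ∈ S then (lam i : ℂ) else 1) * Uᴴ := by
    rw [one_sub_psdProj hU, hdiag]
    simp only [psdProj, sandwich_diag_mul hU, sandwich_diag_add]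
    refine sandwich_congr U fun i => ?_
    by_cases h : i ∈ S
    · simp [h]
    · simp [h]
  rw [hform, Matrix.det_mul, Matrix.det_mul, det_diagonal]
  calc U.det * (∏ i, if i ∈ S then (lam i : ℂ) else 1) * Uᴴ.det
      = (∏ i, if i ∈ S then (lam i : ℂ) else 1) * (Uᴴ.det * U.det) := by ring
    _ = ∏ i ∈ S, (lam i : ℂ) := by
        rw [det_conjTranspose_mul_det_of_unitary hU, mul_one, Finset.prod_ite_mem,
          Finset.univ_inter]

/-- **The "large" factor's determinant**: `det(P + P̄ M†M) = ∏_{i∈S̄} λᵢ` (the factor treated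
stochastically; with (4.35), `∏_{i∈S} λᵢ · det(P + P̄M†M) = det M†M = |det M|²`, the middle term of
(4.40)). [cite: KnechtliWolff2003, §4.3 eqs. (4.33), (4.35), (4.40)] -/
theorem det_psd_large_factor (hU : Uᴴ * U = 1)
    (hdiag : Mᴴ * M = U * diagonal (fun i => (lam i : ℂ)) * Uᴴ) (S : Finset ι) :
    (psdProj U S + (1 - psdProj U S) * (Mᴴ * M)).det = ∏ i ∈ Sᶜ, (lam i : ℂ) := by
  have hform : psdProj U S + (1 - psdProj U S) * (Mᴴ * M)
      = U * diagonal (fun i => if i ∈ Sᶜ then (lam i : ℂ) else 1) * Uᴴ := by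
    rw [one_sub_psdProj hU, hdiag]
    simp only [psdProj, sandwich_diag_mul hU, sandwich_diag_add]
    refine sandwich_congr U fun i => ?_
    by_cases h : i ∈ S
    · simp [h]
    · simp [h]
  rw [hform, Matrix.det_mul, Matrix.det_mul, det_diagonal]
  calc U.det * (∏ i, if i ∈ Sᶜ then (lam i : ℂ) else 1) * Uᴴ.det
      = (∏ i, if i ∈ Sᶜ then (lam i : ℂ) else 1) * (Uᴴ.det * U.det) := by ring
    _ = ∏ i ∈ Sᶜ, (lam i : ℂ) := by
        rw [det_conjTranspose_mul_det_of_unitary hU, mul_one, Finset.prod_ite_mem,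
          Finset.univ_inter]

/-- **The middle term of (4.40)**: `∏_{i∈S} λᵢ · det(P + P̄M†M) = |det M|²` (as complex numbers:
`det M†M = conj(det M) det M`). [cite: KnechtliWolff2003, §4.3 eq. (4.40)] -/
theorem prod_mul_det_psd_large_factor (hU : Uᴴ * U = 1)
    (hdiag : Mᴴ * M = U * diagonal (fun i => (lam i : ℂ)) * Uᴴ) (S : Finset ι) :
    (∏ i ∈ S, (lam i : ℂ)) * (psdProj U S + (1 - psdProj U S) * (Mᴴ * M)).det = (Mᴴ * M).det := by
  rw [det_psd_large_factor hU hdiag S, Finset.prod_mul_prod_compl, hdiag, Matrix.det_mul,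
    Matrix.det_mul, det_diagonal]
  calc ∏ i, (lam i : ℂ) = (∏ i, (lam i : ℂ)) * (Uᴴ.det * U.det) := by
        rw [det_conjTranspose_mul_det_of_unitary hU, mul_one]
    _ = U.det * (∏ i, (lam i : ℂ)) * Uᴴ.det := by ring

/-- **The eigenvalues of `M†M` are positive** for invertible `M` ("eigenvalues `0 < λᵢ < ∞`"):
`λᵢ = ‖MUeᵢ‖² > 0`. [cite: KnechtliWolff2003, App. A (sentence after (A.1))]; [folklore] -/
theorem eigenvalue_pos (hM : M.det ≠ 0) (hU : Uᴴ * U = 1)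
    (hdiag : Mᴴ * M = U * diagonal (fun i => (lam i : ℂ)) * Uᴴ) (i : ι) : 0 < lam i := by
  set w : ι → ℂ := U *ᵥ (Pi.single i 1) with hw
  have hUw : Uᴴ *ᵥ w = Pi.single i 1 := by rw [hw, mulVec_mulVec, hU, one_mulVec]
  have hquad : (star w ⬝ᵥ (Mᴴ * M) *ᵥ w).re = lam i := by
    rw [hdiag, re_star_dotProduct_sandwich_mulVec, hUw,
      Finset.sum_eq_single i (fun j _ hji => by simp [hji])
        (fun h => absurd (Finset.mem_univ i) h)]
    simp
  have hsum := re_star_dotProduct_conjTranspose_mul_self_mulVec M w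
  rw [hquad] at hsum
  -- `lam i = Σⱼ ‖(Mw)ⱼ‖² ≥ 0`, and `= 0` would force `Mw = 0`, `w = 0`, `eᵢ = 0`
  rw [hsum]
  rcases (Finset.sum_nonneg fun j (_ : j ∈ Finset.univ) => sq_nonneg ‖(M *ᵥ w) j‖).lt_or_eq
    with hlt | heq
  · exact hlt
  · exfalso
    have hMw : M *ᵥ w = 0 := by
      funext j
      have hj := (Finset.sum_eq_zero_iff_of_nonneg fun j (_ : j ∈ Finset.univ) =>
        sq_nonneg ‖(M *ᵥ w) j‖).mp heq.symm j (Finset.mem_univ j)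
      exact norm_eq_zero.mp ((pow_eq_zero_iff two_ne_zero).mp hj)
    have hw0 : w = 0 := Matrix.eq_zero_of_mulVec_eq_zero hM hMw
    have h1 : (Pi.single i (1 : ℂ) : ι → ℂ) i = 0 := by
      rw [← hUw, hw0, mulVec_zero]; rfl
    simp at h1

/-- `∏ᵢ λᵢ = det M†M = |det M|²`. [cite: KnechtliWolff2003, §4.3 (4.40) (`∏ᵢλᵢ⁻¹ … = |det M|⁻²`)];
[folklore] -/
theorem prod_eigenvalues_eq_normSq_det (hU : Uᴴ * U = 1)
    (hdiag : Mᴴ * M = U * diagonal (fun i => (lam i : ℂ)) * Uᴴ) : ∏ i, lam i = ‖M.det‖ ^ 2 := by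
  have h2 : (Mᴴ * M).det = ((∏ i, lam i : ℝ) : ℂ) := by
    rw [hdiag, Matrix.det_mul, Matrix.det_mul, det_diagonal, Complex.ofReal_prod]
    calc U.det * (∏ i, (lam i : ℂ)) * Uᴴ.det = (∏ i, (lam i : ℂ)) * (Uᴴ.det * U.det) := by ring
      _ = ∏ i, (lam i : ℂ) := by rw [det_conjTranspose_mul_det_of_unitary hU, mul_one]
  have h3 := congrArg Complex.re h2
  rw [re_det_conjTranspose_mul_self, Complex.ofReal_re] at h3
  exact h3.symm

end Projector

/-! ## The acceptance criterion (4.36) and its `η`-average -/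

section Acceptance

variable {M U : Matrix ι ι ℂ} {lam : ι → ℝ}

/-- **The partially stochastic acceptance criterion (4.36)**:
`w_s(A,A') = min[1, ∏_{i∈S} λᵢ⁻¹ exp(−η†P̄(M†M − 1)P̄η)]`, `P̄ = 1 − P`, as a function of the noise
`η` (the `λᵢ`, `i ∈ S`, and `P` being the exactly computed extremal eigen-data of `M†M`).
[cite: KnechtliWolff2003, §4.3 eq. (4.36)] -/
noncomputable def psdAccept (M U : Matrix ι ι ℂ) (lam : ι → ℝ) (S : Finset ι) (η : ι → ℂ) : ℝ :=
  min 1 ((∏ i ∈ S, lam i)⁻¹ *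
    Real.exp (-(star η ⬝ᵥ ((1 - psdProj U S) * (Mᴴ * M - 1) * (1 - psdProj U S)) *ᵥ η).re))

/-- `P̄(M†M − 1)P̄ = U diag((λᵢ − 1)1_{i∈S̄}) U†`. [cite: KnechtliWolff2003, §4.3 (4.36) with (4.29), (4.34)] -/
theorem psd_sandwich (hU : Uᴴ * U = 1)
    (hdiag : Mᴴ * M = U * diagonal (fun i => (lam i : ℂ)) * Uᴴ) (S : Finset ι) :
    (1 - psdProj U S) * (Mᴴ * M - 1) * (1 - psdProj U S)
      = U * diagonal (fun i => ((if i ∈ Sᶜ then lam i - 1 else 0 : ℝ) : ℂ)) * Uᴴ := by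
  have hU' : U * Uᴴ = 1 := mul_eq_one_comm.mp hU
  have h1 : Mᴴ * M - 1 = U * diagonal (fun i => (lam i : ℂ) - 1) * Uᴴ := by
    have h1' : (1 : Matrix ι ι ℂ) = U * diagonal (fun _ => (1 : ℂ)) * Uᴴ := by
      rw [diagonal_one, Matrix.mul_one, hU']
    rw [hdiag, h1', ← Matrix.sub_mul, ← Matrix.mul_sub, diagonal_sub]
  rw [one_sub_psdProj hU, h1]
  simp only [psdProj, sandwich_diag_mul hU]
  refine sandwich_congr U fun i => ?_
  by_cases h : i ∈ Sᶜ
  · simp [h]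
  · simp [h]

/-- **(4.36) in the eigenbasis**: `w_s = min[1, ∏_{i∈S}λᵢ⁻¹ exp(−Σ_{i∈S̄} (λᵢ − 1)|(U†η)ᵢ|²)]`.
[cite: KnechtliWolff2003, §4.3 eq. (4.36) with §4.1 (4.11)–(4.12)] -/
theorem psdAccept_eq (hU : Uᴴ * U = 1)
    (hdiag : Mᴴ * M = U * diagonal (fun i => (lam i : ℂ)) * Uᴴ) (S : Finset ι) (η : ι → ℂ) :
    psdAccept M U lam S η = min 1 ((∏ i ∈ S, lam i)⁻¹ *
      Real.exp (-(∑ i ∈ Sᶜ, (lam i - 1) * ‖(Uᴴ *ᵥ η) i‖ ^ 2))) := by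
  rw [psdAccept, psd_sandwich hU hdiag, re_star_dotProduct_sandwich_mulVec]
  have hsum : ∑ i, (if i ∈ Sᶜ then lam i - 1 else 0 : ℝ) * ‖(Uᴴ *ᵥ η) i‖ ^ 2
      = ∑ i ∈ Sᶜ, (lam i - 1) * ‖(Uᴴ *ᵥ η) i‖ ^ 2 := by
    have h : ∀ i, (if i ∈ Sᶜ then lam i - 1 else 0 : ℝ) * ‖(Uᴴ *ᵥ η) i‖ ^ 2
        = if i ∈ Sᶜ then (lam i - 1) * ‖(Uᴴ *ᵥ η) i‖ ^ 2 else 0 := fun i => by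
      split_ifs <;> simp
    simp_rw [h]
    rw [Finset.sum_ite_mem, Finset.univ_inter]
  rw [hsum]

/-- `0 < w_s`. [cite: KnechtliWolff2003, §4.3 eq. (4.36)] -/
theorem psdAccept_pos {S : Finset ι} (hS : ∀ i ∈ S, 0 < lam i) (η : ι → ℂ) :
    0 < psdAccept M U lam S η :=
  lt_min one_pos (mul_pos (inv_pos.mpr (Finset.prod_pos hS)) (Real.exp_pos _))

/-- `w_s ≤ 1`. [cite: KnechtliWolff2003, §4.3 eq. (4.36)] -/
theorem psdAccept_le_one (S : Finset ι) (η : ι → ℂ) : psdAccept M U lam S η ≤ 1 :=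
  min_le_left _ _

/-- **Extremal case `S = ∅` (fully stochastic)**: `w_s = min[1, exp(−η†(M†M − 1)η)]
= min[1, ρ(Mη)/ρ(η)] = w₀` of (4.7) ("a family of (exact) algorithms which contains those based on
exact and on fully stochastic determinants as extremal cases").
[cite: KnechtliWolff2003, §4 (opening paragraph), §4.1 eq. (4.7), §4.3 eq. (4.36)] -/
theorem psdAccept_empty (M U : Matrix ι ι ℂ) (lam : ι → ℝ) (η : ι → ℂ) :
    psdAccept M U lam ∅ η
      = min 1 (Real.exp (-(∑ i, ‖(M *ᵥ η) i‖ ^ 2 - ∑ i, ‖η i‖ ^ 2))) := by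
  have hP : psdProj U ∅ = 0 := by
    rw [psdProj]
    simp [Finset.notMem_empty]
  have h1 : star η ⬝ᵥ (Mᴴ * M - 1) *ᵥ η = star η ⬝ᵥ (Mᴴ * M) *ᵥ η - star η ⬝ᵥ η := by
    rw [Matrix.sub_mulVec, Matrix.one_mulVec, dotProduct_sub]
  have h2 : (star η ⬝ᵥ η).re = ∑ i, ‖η i‖ ^ 2 := by
    simp only [dotProduct, Pi.star_apply, Complex.star_def, Complex.conj_mul', Complex.re_sum]
    refine Finset.sum_congr rfl fun i _ => ?_
    norm_cast
  rw [psdAccept, hP, sub_zero, Matrix.one_mul, Matrix.mul_one, Finset.prod_empty, inv_one, one_mul,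
    h1, Complex.sub_re, re_star_dotProduct_conjTranspose_mul_self_mulVec, h2]

/-- **Extremal case `S̄ = ∅` (all eigenvalues exact)**: `w_s = min[1, ∏ᵢ λᵢ⁻¹] = min[1, |det M|⁻²]`,
the exact-determinant Metropolis acceptance of §3.1, independently of the noise `η`.
[cite: KnechtliWolff2003, §4 (opening paragraph), §3.1 eq. (3.1), §4.3 eqs. (4.35)–(4.36)] -/
theorem psdAccept_univ (hU : Uᴴ * U = 1)
    (hdiag : Mᴴ * M = U * diagonal (fun i => (lam i : ℂ)) * Uᴴ) (η : ι → ℂ) :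
    psdAccept M U lam Finset.univ η = min 1 (‖M.det‖ ^ 2)⁻¹ := by
  have hU' : U * Uᴴ = 1 := mul_eq_one_comm.mp hU
  have hP : psdProj U Finset.univ = 1 := by
    rw [psdProj]
    simp only [Finset.mem_univ, if_true, diagonal_one, Matrix.mul_one, hU']
  rw [psdAccept, hP, sub_self]
  simp only [Matrix.zero_mul, Matrix.zero_mulVec, dotProduct_zero, Complex.zero_re, neg_zero,
    Real.exp_zero, mul_one]
  rw [← prod_eigenvalues_eq_normSq_det hU hdiag]

/-- **`⟨w_s(A,A')⟩_η = F(λ; S)`: the `η`-average of the PSD criterion is Knechtli–Wolff's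
acceptance rate for the given spectrum** — with `D[η]ρ(η) = ∏ d Re η d Im η e^{−|η|²}/π`,
`∫_{ℂ^ι} e^{−‖η‖²} w_s(η) dη = π^{|ι|} F(λ; S)` (change to the eigenbasis `η = Uz`, `|det U|² = 1`,
`‖Uz‖ = ‖z‖`; then `(|zᵢ|²)ᵢ` are i.i.d. `Exp(1)`).
[cite: KnechtliWolff2003, §4.3 (4.36)–(4.38) with §4.1 (4.11)–(4.13) and App. A (A.1)] -/
theorem integral_exp_neg_normSq_mul_psdAccept (hU : Uᴴ * U = 1)
    (hdiag : Mᴴ * M = U * diagonal (fun i => (lam i : ℂ)) * Uᴴ) (S : Finset ι) :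
    ∫ η : ι → ℂ, Real.exp (-(∑ i, ‖η i‖ ^ 2)) * psdAccept M U lam S η
      = Real.pi ^ Fintype.card ι * psdF lam S := by
  set G : (ι → ℝ) → ℝ := fun u =>
    min 1 ((∏ i ∈ S, lam i)⁻¹ * Real.exp (-(∑ i ∈ Sᶜ, (lam i - 1) * u i))) with hG
  have hGm : Measurable G := by simp only [hG]; fun_prop
  -- substitute `η = Uz`
  have hcov := integral_comp_mulVec U (det_ne_zero_of_unitary hU)
    (fun η => Real.exp (-(∑ i, ‖η i‖ ^ 2)) * psdAccept M U lam S η)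
  rw [normSq_det_of_unitary hU, inv_one, one_mul] at hcov
  rw [← hcov]
  have hpt : ∀ z : ι → ℂ, Real.exp (-(∑ i, ‖(U *ᵥ z) i‖ ^ 2)) * psdAccept M U lam S (U *ᵥ z)
      = Real.exp (-(∑ i, ‖z i‖ ^ 2)) * G (fun i => ‖z i‖ ^ 2) := by
    intro z
    rw [sum_normSq_mulVec_of_unitary' hU, psdAccept_eq hU hdiag, mulVec_mulVec, hU, one_mulVec]
  simp_rw [hpt]
  rw [integral_exp_neg_mul_radial_eq G hGm, psdF]

/-- **The PSD "Carnot" bound**: `⟨w_s(A,A')⟩_η ≤ min(1, |det M|⁻²)`, here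
`∫ e^{−‖η‖²} w_s dη ≤ min(π^{|ι|}, π^{|ι|}/|det M|²)` — every member of the family is bounded by the
exact-determinant acceptance ((4.9) is the case `S = ∅`).
[cite: KnechtliWolff2003, §4.1 eq. (4.9) and the sentence after it; App. A (A.5)] -/
theorem integral_exp_neg_normSq_mul_psdAccept_le (hM : M.det ≠ 0) (hU : Uᴴ * U = 1)
    (hdiag : Mᴴ * M = U * diagonal (fun i => (lam i : ℂ)) * Uᴴ) (S : Finset ι) :
    ∫ η : ι → ℂ, Real.exp (-(∑ i, ‖η i‖ ^ 2)) * psdAccept M U lam S η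
      ≤ min (Real.pi ^ Fintype.card ι) (Real.pi ^ Fintype.card ι / ‖M.det‖ ^ 2) := by
  rw [integral_exp_neg_normSq_mul_psdAccept hU hdiag S, ← prod_eigenvalues_eq_normSq_det hU hdiag,
    div_eq_mul_inv]
  conv_rhs => rw [← mul_one (Real.pi ^ Fintype.card ι)]
  rw [show Real.pi ^ Fintype.card ι * 1 * (∏ i, lam i)⁻¹ = Real.pi ^ Fintype.card ι * (∏ i, lam i)⁻¹
      by rw [mul_one], ← mul_min_of_nonneg _ _ (pow_nonneg Real.pi_pos.le _)]
  exact mul_le_mul_of_nonneg_left (psdF_le_min (eigenvalue_pos hM hU hdiag) S)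
    (pow_nonneg Real.pi_pos.le _)

end Acceptance

/-! ## The reverse move (4.30)–(4.32) and detailed balance (4.40) -/

section DetailedBalance

variable {M U : Matrix ι ι ℂ} {lam : ι → ℝ}

/-- **The eigenbasis of the reverse problem (4.30)–(4.32)**: the columns `Mφᵢ/√λᵢ` of `M U diag(λ^{−1/2})`
are orthonormal eigenvectors of `(M⁻¹)†M⁻¹ = (MM†)⁻¹` with eigenvalues `1/λᵢ` ("Its eigenvalues are
reciprocal to those of `M†M` but the eigenvectors … are different … related by a unitary
transformation"). [cite: KnechtliWolff2003, §4.3 eqs. (4.30)–(4.32)] -/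
noncomputable def psdReverseBasis (M U : Matrix ι ι ℂ) (lam : ι → ℝ) : Matrix ι ι ℂ :=
  M * U * diagonal (fun i => (((Real.sqrt (lam i))⁻¹ : ℝ) : ℂ))

omit [Fintype ι] in
/-- A real diagonal matrix is Hermitian. [folklore] -/
private theorem diagonal_ofReal_conjTranspose (d : ι → ℝ) :
    (diagonal (fun i => ((d i : ℝ) : ℂ)))ᴴ = diagonal (fun i => ((d i : ℝ) : ℂ)) := by
  rw [diagonal_conjTranspose]
  congr 1
  funext i
  exact Complex.conj_ofReal _

/-- The key identity behind (4.30)–(4.32): `diag(λ⁻¹) U† M† = U† M⁻¹` (both are `U†` after right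
multiplication by `M`). [cite: KnechtliWolff2003, §4.3 (4.30)–(4.31)]; [folklore] -/
theorem diagonal_inv_mul_conjTranspose_mul_conjTranspose (hM : M.det ≠ 0) (hU : Uᴴ * U = 1)
    (hdiag : Mᴴ * M = U * diagonal (fun i => (lam i : ℂ)) * Uᴴ) (hpos : ∀ i, 0 < lam i) :
    diagonal (fun i => (((lam i)⁻¹ : ℝ) : ℂ)) * Uᴴ * Mᴴ = Uᴴ * M⁻¹ := by
  have h1 : diagonal (fun i => (((lam i)⁻¹ : ℝ) : ℂ)) * Uᴴ * Mᴴ * M = Uᴴ := by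
    calc diagonal (fun i => (((lam i)⁻¹ : ℝ) : ℂ)) * Uᴴ * Mᴴ * M
        = diagonal (fun i => (((lam i)⁻¹ : ℝ) : ℂ)) * Uᴴ * (Mᴴ * M) := by
          simp only [Matrix.mul_assoc]
      _ = diagonal (fun i => (((lam i)⁻¹ : ℝ) : ℂ)) * (Uᴴ * U) * diagonal (fun i => (lam i : ℂ))
            * Uᴴ := by rw [hdiag]; simp only [Matrix.mul_assoc]
      _ = Uᴴ := by
          rw [hU, Matrix.mul_one, diagonal_mul_diagonal]
          have : (fun i => (((lam i)⁻¹ : ℝ) : ℂ) * (lam i : ℂ)) = fun _ => (1 : ℂ) := by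
            funext i
            have : (lam i)⁻¹ * lam i = 1 := inv_mul_cancel₀ (hpos i).ne'
            exact_mod_cast this
          rw [this, diagonal_one, Matrix.one_mul]
  calc diagonal (fun i => (((lam i)⁻¹ : ℝ) : ℂ)) * Uᴴ * Mᴴ
      = diagonal (fun i => (((lam i)⁻¹ : ℝ) : ℂ)) * Uᴴ * Mᴴ * (M * M⁻¹) := by
        rw [Matrix.mul_nonsing_inv M (Ne.isUnit hM), Matrix.mul_one]
    _ = diagonal (fun i => (((lam i)⁻¹ : ℝ) : ℂ)) * Uᴴ * Mᴴ * M * M⁻¹ := by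
        simp only [Matrix.mul_assoc]
    _ = Uᴴ * M⁻¹ := by rw [h1]

/-- **The reverse eigenbasis is unitary.** [cite: KnechtliWolff2003, §4.3 eq. (4.30) (`U†U = 1 = UU†`)] -/
theorem psdReverseBasis_conjTranspose_mul_self (hU : Uᴴ * U = 1)
    (hdiag : Mᴴ * M = U * diagonal (fun i => (lam i : ℂ)) * Uᴴ) (hpos : ∀ i, 0 < lam i) :
    (psdReverseBasis M U lam)ᴴ * psdReverseBasis M U lam = 1 := by
  set D : Matrix ι ι ℂ := diagonal (fun i => (((Real.sqrt (lam i))⁻¹ : ℝ) : ℂ)) with hD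
  have hDh : Dᴴ = D := diagonal_ofReal_conjTranspose _
  rw [psdReverseBasis, ← hD, conjTranspose_mul, conjTranspose_mul, hDh]
  calc D * (Uᴴ * Mᴴ) * (M * U * D) = D * (Uᴴ * (Mᴴ * M) * U) * D := by
        simp only [Matrix.mul_assoc]
    _ = D * diagonal (fun i => (lam i : ℂ)) * D := by rw [hdiag, conjTranspose_sandwich hU]
    _ = 1 := by
        rw [hD, diagonal_mul_diagonal, diagonal_mul_diagonal, ← diagonal_one]
        congr 1
        funext i
        set s : ℝ := Real.sqrt (lam i) with hs
        have hs0 : s ≠ 0 := Real.sqrt_ne_zero'.mpr (hpos i)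
        have hs2 : s * s = lam i := Real.mul_self_sqrt (hpos i).le
        have hreal : s⁻¹ * lam i * s⁻¹ = 1 := by rw [← hs2]; field_simp
        exact_mod_cast hreal

/-- **The reverse eigenbasis diagonalises `(M⁻¹)†M⁻¹ = (MM†)⁻¹` with the reciprocal eigenvalues.**
[cite: KnechtliWolff2003, §4.3 eq. (4.30) ("`MM† = U†M†MU`")] -/
theorem conjTranspose_mul_self_inv_eq (hM : M.det ≠ 0) (hU : Uᴴ * U = 1)
    (hdiag : Mᴴ * M = U * diagonal (fun i => (lam i : ℂ)) * Uᴴ) (hpos : ∀ i, 0 < lam i) :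
    (M⁻¹)ᴴ * M⁻¹ = psdReverseBasis M U lam * diagonal (fun i => (((lam i)⁻¹ : ℝ) : ℂ))
      * (psdReverseBasis M U lam)ᴴ := by
  have hU' : U * Uᴴ = 1 := mul_eq_one_comm.mp hU
  set D : Matrix ι ι ℂ := diagonal (fun i => (((Real.sqrt (lam i))⁻¹ : ℝ) : ℂ)) with hD
  set L : Matrix ι ι ℂ := diagonal (fun i => (((lam i)⁻¹ : ℝ) : ℂ)) with hL
  have hDh : Dᴴ = D := diagonal_ofReal_conjTranspose _
  have hK := diagonal_inv_mul_conjTranspose_mul_conjTranspose hM hU hdiag hpos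
  rw [← hL] at hK
  -- `D L D = L L`
  have hDLD : D * L * D = L * L := by
    rw [hD, hL, diagonal_mul_diagonal, diagonal_mul_diagonal, diagonal_mul_diagonal]
    congr 1
    funext i
    set s : ℝ := Real.sqrt (lam i) with hs
    have hs0 : s ≠ 0 := Real.sqrt_ne_zero'.mpr (hpos i)
    have hl0 : lam i ≠ 0 := (hpos i).ne'
    have hs2 : s * s = lam i := Real.mul_self_sqrt (hpos i).le
    have hreal : s⁻¹ * (lam i)⁻¹ * s⁻¹ = (lam i)⁻¹ * (lam i)⁻¹ := by
      rw [← hs2]; field_simp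
    exact_mod_cast hreal
  -- `(M†)⁻¹ = M U L U†`
  have hinv : (Mᴴ)⁻¹ = M * U * L * Uᴴ := by
    refine Matrix.inv_eq_left_inv ?_
    calc M * U * L * Uᴴ * Mᴴ = M * U * (L * Uᴴ * Mᴴ) := by simp only [Matrix.mul_assoc]
      _ = M * U * (Uᴴ * M⁻¹) := by rw [hK]
      _ = M * (U * Uᴴ) * M⁻¹ := by simp only [Matrix.mul_assoc]
      _ = 1 := by rw [hU', Matrix.mul_one, Matrix.mul_nonsing_inv M (Ne.isUnit hM)]
  rw [psdReverseBasis, ← hD, conjTranspose_mul, conjTranspose_mul, hDh, conjTranspose_nonsing_inv,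
    hinv]
  calc M * U * L * Uᴴ * M⁻¹ = M * U * L * (Uᴴ * M⁻¹) := by simp only [Matrix.mul_assoc]
    _ = M * U * L * (L * Uᴴ * Mᴴ) := by rw [hK]
    _ = M * U * (L * L) * Uᴴ * Mᴴ := by simp only [Matrix.mul_assoc]
    _ = M * U * (D * L * D) * Uᴴ * Mᴴ := by rw [hDLD]
    _ = M * U * D * L * (D * (Uᴴ * Mᴴ)) := by simp only [Matrix.mul_assoc]

/-- **(4.32) the projector of the reverse problem**: `P(A',A) = M P(A,A') M⁻¹` (the span of the
`Mφᵢ`, `i ∈ S`; printed as `U†P(A,A')U` with `U = M†(MM†)^{−1/2}` (4.31)).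
[cite: KnechtliWolff2003, §4.3 eqs. (4.31)–(4.32)] -/
theorem psdProj_psdReverseBasis (hM : M.det ≠ 0) (hU : Uᴴ * U = 1)
    (hdiag : Mᴴ * M = U * diagonal (fun i => (lam i : ℂ)) * Uᴴ) (hpos : ∀ i, 0 < lam i)
    (S : Finset ι) :
    psdProj (psdReverseBasis M U lam) S = M * psdProj U S * M⁻¹ := by
  set D : Matrix ι ι ℂ := diagonal (fun i => (((Real.sqrt (lam i))⁻¹ : ℝ) : ℂ)) with hD
  set L : Matrix ι ι ℂ := diagonal (fun i => (((lam i)⁻¹ : ℝ) : ℂ)) with hL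
  set E : Matrix ι ι ℂ := diagonal (fun i => if i ∈ S then (1 : ℂ) else 0) with hE
  have hDh : Dᴴ = D := diagonal_ofReal_conjTranspose _
  have hK := diagonal_inv_mul_conjTranspose_mul_conjTranspose hM hU hdiag hpos
  rw [← hL] at hK
  have hDED : D * E * D = E * L := by
    rw [hD, hE, hL, diagonal_mul_diagonal, diagonal_mul_diagonal, diagonal_mul_diagonal]
    congr 1
    funext i
    by_cases h : i ∈ S
    · rw [if_pos h, mul_one, one_mul]
      set s : ℝ := Real.sqrt (lam i) with hs
      have hs0 : s ≠ 0 := Real.sqrt_ne_zero'.mpr (hpos i)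
      have hs2 : s * s = lam i := Real.mul_self_sqrt (hpos i).le
      have hreal : s⁻¹ * s⁻¹ = (lam i)⁻¹ := by rw [← hs2]; field_simp
      exact_mod_cast hreal
    · rw [if_neg h, mul_zero, zero_mul, zero_mul]
  rw [psdProj, psdProj, psdReverseBasis, ← hD, ← hE, conjTranspose_mul, conjTranspose_mul, hDh]
  calc M * U * D * E * (D * (Uᴴ * Mᴴ)) = M * U * (D * E * D) * Uᴴ * Mᴴ := by
        simp only [Matrix.mul_assoc]
    _ = M * U * (E * L) * Uᴴ * Mᴴ := by rw [hDED]
    _ = M * U * E * (L * Uᴴ * Mᴴ) := by simp only [Matrix.mul_assoc]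
    _ = M * U * E * (Uᴴ * M⁻¹) := by rw [hK]
    _ = M * (U * E * Uᴴ) * M⁻¹ := by simp only [Matrix.mul_assoc]

/-- **KNECHTLI–WOLFF (4.40): DETAILED BALANCE OF THE PARTIALLY STOCHASTIC ACCEPTANCE STEP.**
For an invertible `M` with `M†M = U diag(λ) U†` (`U` unitary), a set `S` of exactly treated
eigenvalues, and ANY unitary eigenbasis `U'` of the reverse problem `(M⁻¹)†M⁻¹ = U' diag(λ⁻¹) U'†`
(the reverse move `A' → A` has the ratio operator `M⁻¹`, reciprocal eigenvalues, and treats the same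
labels `S` exactly):
`∫ e^{−‖η‖²} w_s[M, U, λ, S](η) dη = |det M|⁻² · ∫ e^{−‖η‖²} w_s[M⁻¹, U', λ⁻¹, S](η) dη`,
i.e. `⟨w_s(A,A')⟩_η / ⟨w_s(A',A)⟩_η = |det M|⁻²` — so the PSD step satisfies detailed balance with
respect to the two-flavour weight `|det(D_W + m)|²` exactly as the exact-determinant step does.
[cite: KnechtliWolff2003, §4.3 eqs. (4.36)–(4.40)] -/
theorem psd_detailed_balance (hM : M.det ≠ 0) (hU : Uᴴ * U = 1)
    (hdiag : Mᴴ * M = U * diagonal (fun i => (lam i : ℂ)) * Uᴴ) (S : Finset ι)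
    {U' : Matrix ι ι ℂ} (hU' : U'ᴴ * U' = 1)
    (hdiag' : (M⁻¹)ᴴ * M⁻¹ = U' * diagonal (fun i => (((lam i)⁻¹ : ℝ) : ℂ)) * U'ᴴ) :
    ∫ η : ι → ℂ, Real.exp (-(∑ i, ‖η i‖ ^ 2)) * psdAccept M U lam S η
      = (‖M.det‖ ^ 2)⁻¹ *
        ∫ η : ι → ℂ, Real.exp (-(∑ i, ‖η i‖ ^ 2)) * psdAccept M⁻¹ U' (fun i => (lam i)⁻¹) S η := by
  have hpos := eigenvalue_pos hM hU hdiag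
  rw [integral_exp_neg_normSq_mul_psdAccept hU hdiag S,
    integral_exp_neg_normSq_mul_psdAccept (M := M⁻¹) (lam := fun i => (lam i)⁻¹) hU' hdiag' S,
    psdF_eq_inv_prod_mul_psdF_inv hpos S, prod_eigenvalues_eq_normSq_det hU hdiag]
  ring

/-- **(4.40) with the explicit reverse eigen-data of (4.30)–(4.32)** (`P(A',A) = M P M⁻¹`,
eigenvalues `1/λᵢ`): `⟨w_s(A,A')⟩_η = |det M|⁻² ⟨w_s(A',A)⟩_η`.
[cite: KnechtliWolff2003, §4.3 eqs. (4.30)–(4.40)] -/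
theorem psd_detailed_balance_reverseBasis (hM : M.det ≠ 0) (hU : Uᴴ * U = 1)
    (hdiag : Mᴴ * M = U * diagonal (fun i => (lam i : ℂ)) * Uᴴ) (S : Finset ι) :
    ∫ η : ι → ℂ, Real.exp (-(∑ i, ‖η i‖ ^ 2)) * psdAccept M U lam S η
      = (‖M.det‖ ^ 2)⁻¹ *
        ∫ η : ι → ℂ, Real.exp (-(∑ i, ‖η i‖ ^ 2)) *
          psdAccept M⁻¹ (psdReverseBasis M U lam) (fun i => (lam i)⁻¹) S η :=
  psd_detailed_balance hM hU hdiag S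
    (psdReverseBasis_conjTranspose_mul_self hU hdiag (eigenvalue_pos hM hU hdiag))
    (conjTranspose_mul_self_inv_eq hM hU hdiag (eigenvalue_pos hM hU hdiag))

/-- **(4.40) as printed, as a ratio**: `⟨w_s(A,A')⟩_η / ⟨w_s(A',A)⟩_η = |det M|⁻²`.
[cite: KnechtliWolff2003, §4.3 eq. (4.40)] -/
theorem psd_detailed_balance_div (hM : M.det ≠ 0) (hU : Uᴴ * U = 1)
    (hdiag : Mᴴ * M = U * diagonal (fun i => (lam i : ℂ)) * Uᴴ) (S : Finset ι)
    {U' : Matrix ι ι ℂ} (hU' : U'ᴴ * U' = 1)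
    (hdiag' : (M⁻¹)ᴴ * M⁻¹ = U' * diagonal (fun i => (((lam i)⁻¹ : ℝ) : ℂ)) * U'ᴴ) :
    (∫ η : ι → ℂ, Real.exp (-(∑ i, ‖η i‖ ^ 2)) * psdAccept M U lam S η)
      / (∫ η : ι → ℂ, Real.exp (-(∑ i, ‖η i‖ ^ 2)) * psdAccept M⁻¹ U' (fun i => (lam i)⁻¹) S η)
      = (‖M.det‖ ^ 2)⁻¹ := by
  have hpos := eigenvalue_pos hM hU hdiag
  have hne : (∫ η : ι → ℂ, Real.exp (-(∑ i, ‖η i‖ ^ 2)) *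
      psdAccept M⁻¹ U' (fun i => (lam i)⁻¹) S η) ≠ 0 := by
    rw [integral_exp_neg_normSq_mul_psdAccept (M := M⁻¹) (lam := fun i => (lam i)⁻¹) hU' hdiag' S]
    exact (mul_pos (pow_pos Real.pi_pos _)
      (psdF_pos (S := S) (lam := fun i => (lam i)⁻¹) fun i _ => inv_pos.mpr (hpos i))).ne'
  rw [psd_detailed_balance hM hU hdiag S hU' hdiag', mul_div_assoc, div_self hne, mul_one]

end DetailedBalance

end Literature.MathematicalPhysics.QuantumFieldTheory.StochasticAcceptance
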